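import Summits.AtomisticToContinuum.BoseEinsteinCondensation.Theorems.BECCellInformationOneBodyEntropyBoundAeCoreOrAeZero
import Summits.AtomisticToContinuum.BoseEinsteinCondensation.Theorems.BECCellInformationOneBodyEntropyBoundDirichletFloor
import Summits.AtomisticToContinuum.BoseEinsteinCondensation.Theorems.BECCellInformationOneBodyEntropyBoundCutoffAndCount
import Summits.AtomisticToContinuum.BoseEinsteinCondensation.Theorems.BECCellInformationOneBodyEntropyBoundCubeNeumannBound
import Summits.AtomisticToContinuum.BoseEinsteinCondensation.Theorems.BECCellInformationOneBodyEntropyBoundCagingBound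
import Summits.AtomisticToContinuum.BoseEinsteinCondensation.Theorems.BECCellInformationOneBodyEntropyBoundDenseCellMain
import Summits.AtomisticToContinuum.BoseEinsteinCondensation.Theorems.BECCellInformationOneBodyEntropyBoundJastrowProfile
import Summits.AtomisticToContinuum.BoseEinsteinCondensation.Theorems.BECCellInformationOneBodyEntropyBoundProductJastrow
import Summits.AtomisticToContinuum.BoseEinsteinCondensation.Theorems.BECCellInformationOneBodyEntropyBoundFirstVariation
import Summits.AtomisticToContinuum.BoseEinsteinCondensation.Theorems.BECCellInformationOneBodyEntropyBoundInsertionAssembly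

/-!
# Route `BECCellInformation`, crux `OneBodyEntropyBound` (stmt-AtomisticToContinuum-13440): PROOF

`oneBodyEntropyBound_proof : …Theses.BECCellInformation.OneBodyEntropyBound` — the one-body profile entropy bound
`KL(P¹_Ψ ‖ u_Λ) ≤ C` for every `δ`-near-minimiser `Ψ` of the dilute Dirichlet Bose gas with a repulsive finite-range pair
potential, uniformly in `N`, at every sufficiently small density. Line `registered` (`Cruxes/OneBodyEntropyBound/Lines/birth.lean`):
chain rule over a tiling of fixed side `l` (`stub_cellChainRule`) + within-cell cube LSI with Fisher convexity
(`stub_withinCellFisherLSI`) reduce the crux to the COARSE occupation-law entropy bound, which is the free-gas bound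
(`free_case`) when `v = 0` a.e. on `(0,∞)`, and otherwise the DENSE-CELL bound (`stub_denseCellBound`: one-particle local energy
bound by pointwise IMS + Dirichlet bosonic floor + group extraction; one-body caging bound `stub_cagingBound ∘ stub_cubeNeumannBound`;
cutoff pair and isolated-point count `stub_cutoffAndCount`; densest cell) fed by the INSERTION LEMMA `E₀(n+1,L) ≤ E₀(n,L) + κ`
(`stub_insertionAssembly`: Jastrow-dressed product state `θ(x₀)·Π_j f(x₀−x_j)·Φ`, `stub_jastrowProfile`, `stub_productJastrow`,
and the approximate ground-state representation for near-minimisers `stub_firstVariation`; position averaging).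
-/

noncomputable section

namespace Summit.AtomisticToContinuum.BoseEinsteinCondensation.Theorems

open MeasureTheory Filter
open scoped ENNReal
open Summit.AtomisticToContinuum.BoseEinsteinCondensation.Cruxes.OneBodyEntropyBound.Birth

/-- **The one-body profile entropy bound** (crux `OneBodyEntropyBound` of route `BECCellInformation`): for every repulsive
finite-range `v` there is `ρ₀ > 0` such that for `0 < ρ < ρ₀` there is `C` with: for all large `N = n+1` there is `δ > 0` such
that every `δ`-near-minimiser `Ψ` has `∫_Λ L⁻³ klFun(L³ P¹_Ψ) ≤ C`. [folklore] -/
theorem oneBodyEntropyBound_proof :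
    Summit.AtomisticToContinuum.BoseEinsteinCondensation.Theses.BECCellInformation.OneBodyEntropyBound := by
  unfold Summit.AtomisticToContinuum.BoseEinsteinCondensation.Theses.BECCellInformation.OneBodyEntropyBound
  intro v hv
  by_cases hz : (∀ᵐ r : ℝ ∂(MeasureTheory.volume.restrict (Set.Ioi (0 : ℝ))), v r = 0)
  · exact oneBodyEntropyBound_of_aeCore_or_aeZero v hv (Or.inr hz)
  · exact Partial.of_coarse v hv
      (stub_denseCellBound stub_dirichletFloor (stub_cagingBound stub_cubeNeumannBound) stub_cutoffAndCount v hv hz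
        (stub_insertionAssembly stub_dirichletFloor stub_jastrowProfile stub_productJastrow stub_firstVariation v hv))

end Summit.AtomisticToContinuum.BoseEinsteinCondensation.Theorems

end
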